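import Summits.NavierStokesRegularity.NavierStokesRegularity.Theorems.FilamentSkeletonRssCoreLinearInvertibilityOddAttenuationDecay
import Summits.NavierStokesRegularity.NavierStokesRegularity.Theorems.FilamentSkeletonRssCoreLinearInvertibilityGradientInClassTools
import Summits.AnomalousDissipation.AnomalousDissipation.Theorems.MarginalStabilityChainStretchedVortexRowsStubCoreInverseTools
import Summits.AnomalousDissipation.AnomalousDissipation.Theorems.MarginalStabilityChainStretchedVortexRowsStubCoreLAngularPairingTools
import Literature.Analysis.FluidPDE.GaussianVortexLinearLamGap

/-!
# Tools H for stub `stub_oddAttenuation` of crux `CoreLinearInvertibility`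
# (stmt-NavierStokesRegularity-17973), line `Sketch`: the ground-state conjugation `ũ = e^{(1−λ)|x|²/8} v`

For `λ ∈ [0,1)` put `a = (1−λ)/8`, `p = e^{a|x|²}` (so that `G_λ⁻¹ = (4π/(1−λ)) p²`) and `ũ = p v`.
Then `∫ G_λ⁻¹ v² = (4π/(1−λ)) ∫ ũ²`, and for the LOCAL linearised operator
`H v = L_λ v − R v^G·∇v` (`L_λ = strainedVorticityOperator`, `v^G·∇v = Ω ∂_θv`):

  `p · (H v) = Δũ + λ x₀∂₀ũ − ((1−λ)²/16 |x|² + λ(1−λ)/4 x₀²) ũ + ((1+λ)/2) ũ − R Ω ∂_θũ`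

pointwise (the isotropic weight version of the tree's `strainedVorticityOperator_weight_mul`; the
rotation commutes with radial weights). Moreover `ũ ∈ C²` is odd when `v` is, and `ũ, Dũ, D²ũ` have
Gaussian decay `e^{−|x|²/8}` (times polynomials) when `v, Dv, D²v` are bounded by
`C(1+|x|)ᴺ e^{−|x|²/4}` — the hypotheses of the flat-`L²` attenuation estimate (tools A–G).
-/

set_option linter.dupNamespace false

noncomputable section

namespace Summit.NavierStokesRegularity.NavierStokesRegularity.Theorems

open MeasureTheory Filter Topology Set
open Literature.Analysis.FluidPDE
open Summit.AnomalousDissipation.AnomalousDissipation.Theorems.MarginalStabilityChainStretchedVortexRows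
open scoped InnerProductSpace Laplacian ContDiff

/-! ### The weight `p = e^{a|x|²}` -/

/-- `p = e^{a|x|²}` is smooth. [folklore] -/
theorem contDiff_expWeight (a : ℝ) {n : WithTop ℕ∞} :
    ContDiff ℝ n fun y : EuclideanSpace ℝ (Fin 2) => Real.exp (a * ‖y‖ ^ 2) :=
  Real.contDiff_exp.comp (contDiff_const.mul (contDiff_norm_sq ℝ))

/-- `Dp(x) = 2a p(x) ⟪x, ·⟫`. [folklore] -/
theorem hasFDerivAt_expWeight (a : ℝ) (x : EuclideanSpace ℝ (Fin 2)) :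
    HasFDerivAt (fun y : EuclideanSpace ℝ (Fin 2) => Real.exp (a * ‖y‖ ^ 2))
      ((2 * a * Real.exp (a * ‖x‖ ^ 2)) • innerSL ℝ x) x := by
  have h1 : HasFDerivAt (fun y : EuclideanSpace ℝ (Fin 2) => ‖y‖ ^ 2) (2 • innerSL ℝ x) x :=
    (hasStrictFDerivAt_norm_sq x).hasFDerivAt
  refine ((h1.const_mul a).exp).congr_fderiv ?_
  ext v
  simp only [FunLike.coe_smul, Pi.smul_apply, smul_eq_mul]
  simp only [coe_innerSL_apply, nsmul_eq_mul, Nat.cast_ofNat]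
  ring

/-- `∂ᵥp(x) = 2a p(x) ⟪x, v⟫`. [folklore] -/
theorem fderiv_expWeight_apply (a : ℝ) (x v : EuclideanSpace ℝ (Fin 2)) :
    fderiv ℝ (fun y : EuclideanSpace ℝ (Fin 2) => Real.exp (a * ‖y‖ ^ 2)) x v =
      2 * a * Real.exp (a * ‖x‖ ^ 2) * ⟪x, v⟫_ℝ := by
  rw [(hasFDerivAt_expWeight a x).fderiv]
  simp only [FunLike.coe_smul, Pi.smul_apply, smul_eq_mul, coe_innerSL_apply]

/-- `‖Dp(x)‖ = 2|a| p(x) |x|`. [folklore] -/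
theorem norm_fderiv_expWeight (a : ℝ) (x : EuclideanSpace ℝ (Fin 2)) :
    ‖fderiv ℝ (fun y : EuclideanSpace ℝ (Fin 2) => Real.exp (a * ‖y‖ ^ 2)) x‖ =
      2 * |a| * Real.exp (a * ‖x‖ ^ 2) * ‖x‖ := by
  rw [(hasFDerivAt_expWeight a x).fderiv, norm_smul, innerSL_apply_norm, Real.norm_eq_abs, abs_mul, abs_mul,
    abs_two, abs_of_pos (Real.exp_pos _)]

/-- `∂ᵢp = −((−4a) xᵢ/2) p`: the weight `p` in the format of the tree's conjugation lemmas. [folklore] -/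
theorem fderiv_expWeight_single (a : ℝ) (i : Fin 2) (x : EuclideanSpace ℝ (Fin 2)) :
    fderiv ℝ (fun y : EuclideanSpace ℝ (Fin 2) => Real.exp (a * ‖y‖ ^ 2)) x (EuclideanSpace.single i (1 : ℝ)) =
      -((-4 * a) * x i / 2) * Real.exp (a * ‖x‖ ^ 2) := by
  rw [fderiv_expWeight_apply, EuclideanSpace.inner_single_right]
  simp
  ring

/-! ### The conjugated function `ũ = p v`: derivatives and their bounds -/

section Conj

variable {v : EuclideanSpace ℝ (Fin 2) → ℝ} (hv : ContDiff ℝ 2 v) (a : ℝ)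
include hv

/-- `∂_w(p v)(x) = p(x) (∂_w v(x) + 2a ⟪w, x⟫ v(x))`. [folklore] -/
theorem fderiv_expWeight_mul_apply (x w : EuclideanSpace ℝ (Fin 2)) :
    fderiv ℝ (fun y : EuclideanSpace ℝ (Fin 2) => Real.exp (a * ‖y‖ ^ 2) * v y) x w =
      Real.exp (a * ‖x‖ ^ 2) * (fderiv ℝ v x w + 2 * a * ⟪w, x⟫_ℝ * v x) := by
  have hvd : HasFDerivAt v (fderiv ℝ v x) x := (hv.differentiable two_ne_zero x).hasFDerivAt
  rw [((hasFDerivAt_expWeight a x).fun_mul hvd).fderiv]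
  simp only [add_apply, FunLike.coe_smul, Pi.smul_apply, smul_eq_mul, coe_innerSL_apply, real_inner_comm x w]
  ring

/-- `D²(p v)(x)[v'][w] = p(x) (2a⟪v', x⟫ (∂_w v + 2a⟪w, x⟫ v) + D²v[v'][w] + 2a⟪w, v'⟫ v + 2a⟪w, x⟫ ∂_{v'} v)`. [folklore] -/
theorem fderiv_fderiv_expWeight_mul_apply (x v' w : EuclideanSpace ℝ (Fin 2)) :
    fderiv ℝ (fderiv ℝ (fun y : EuclideanSpace ℝ (Fin 2) => Real.exp (a * ‖y‖ ^ 2) * v y)) x v' w =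
      Real.exp (a * ‖x‖ ^ 2) * (2 * a * ⟪v', x⟫_ℝ * (fderiv ℝ v x w + 2 * a * ⟪w, x⟫_ℝ * v x) +
        fderiv ℝ (fderiv ℝ v) x v' w + 2 * a * ⟪w, v'⟫_ℝ * v x + 2 * a * ⟪w, x⟫_ℝ * fderiv ℝ v x v') := by
  have hpu : ContDiff ℝ 2 (fun y : EuclideanSpace ℝ (Fin 2) => Real.exp (a * ‖y‖ ^ 2) * v y) :=
    (contDiff_expWeight a).mul hv
  rw [← fderiv_partialDeriv_apply hpu x v' w]
  have hfun : (fun y : EuclideanSpace ℝ (Fin 2) => fderiv ℝ (fun z : EuclideanSpace ℝ (Fin 2) =>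
      Real.exp (a * ‖z‖ ^ 2) * v z) y w) = fun y => Real.exp (a * ‖y‖ ^ 2) *
      (fderiv ℝ v y w + 2 * a * ⟪w, y⟫_ℝ * v y) := funext fun y => fderiv_expWeight_mul_apply hv a y w
  rw [hfun]
  have hvd : HasFDerivAt v (fderiv ℝ v x) x := (hv.differentiable two_ne_zero x).hasFDerivAt
  have hdw : HasFDerivAt (fun y => fderiv ℝ v y w) (fderiv ℝ (fun y => fderiv ℝ v y w) x) x :=
    ((contDiff_one_partialDeriv hv w).differentiable one_ne_zero x).hasFDerivAt
  have hi : HasFDerivAt (fun y : EuclideanSpace ℝ (Fin 2) => ⟪w, y⟫_ℝ) (innerSL ℝ w) x := (innerSL ℝ w).hasFDerivAt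
  have hinner : HasFDerivAt (fun y : EuclideanSpace ℝ (Fin 2) => 2 * a * ⟪w, y⟫_ℝ * v y)
      ((2 * a * ⟪w, x⟫_ℝ) • fderiv ℝ v x + v x • ((2 * a) • innerSL ℝ w)) x := (hi.const_mul (2 * a)).fun_mul hvd
  rw [((hasFDerivAt_expWeight a x).fun_mul (hdw.fun_add hinner)).fderiv]
  simp only [add_apply, FunLike.coe_smul, Pi.smul_apply, smul_eq_mul, coe_innerSL_apply,
    fderiv_partialDeriv_apply hv, real_inner_comm x v']
  ring

/-- `‖D(p v)(x)‖ ≤ p(x) (‖Dv(x)‖ + 2|a| |x| |v(x)|)`. [folklore] -/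
theorem norm_fderiv_expWeight_mul_le (x : EuclideanSpace ℝ (Fin 2)) :
    ‖fderiv ℝ (fun y : EuclideanSpace ℝ (Fin 2) => Real.exp (a * ‖y‖ ^ 2) * v y) x‖ ≤
      Real.exp (a * ‖x‖ ^ 2) * (‖fderiv ℝ v x‖ + 2 * |a| * ‖x‖ * |v x|) := by
  have hp := Real.exp_pos (a * ‖x‖ ^ 2)
  refine ContinuousLinearMap.opNorm_le_bound _ (by positivity) fun w => ?_
  have h1 : |fderiv ℝ v x w| ≤ ‖fderiv ℝ v x‖ * ‖w‖ := by
    rw [← Real.norm_eq_abs]; exact ContinuousLinearMap.le_opNorm _ _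
  have h2 : |⟪w, x⟫_ℝ| ≤ ‖w‖ * ‖x‖ := abs_real_inner_le_norm w x
  have hmain : |fderiv ℝ v x w + 2 * a * ⟪w, x⟫_ℝ * v x| ≤ (‖fderiv ℝ v x‖ + 2 * |a| * ‖x‖ * |v x|) * ‖w‖ :=
    calc |fderiv ℝ v x w + 2 * a * ⟪w, x⟫_ℝ * v x| ≤ |fderiv ℝ v x w| + |2 * a * ⟪w, x⟫_ℝ * v x| := abs_add_le _ _
      _ = |fderiv ℝ v x w| + 2 * |a| * |⟪w, x⟫_ℝ| * |v x| := by simp only [abs_mul, abs_two]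
      _ ≤ ‖fderiv ℝ v x‖ * ‖w‖ + 2 * |a| * (‖w‖ * ‖x‖) * |v x| := by gcongr
      _ = (‖fderiv ℝ v x‖ + 2 * |a| * ‖x‖ * |v x|) * ‖w‖ := by ring
  calc ‖fderiv ℝ (fun y : EuclideanSpace ℝ (Fin 2) => Real.exp (a * ‖y‖ ^ 2) * v y) x w‖
      = Real.exp (a * ‖x‖ ^ 2) * |fderiv ℝ v x w + 2 * a * ⟪w, x⟫_ℝ * v x| := by
        rw [fderiv_expWeight_mul_apply hv a, Real.norm_eq_abs, abs_mul, abs_of_pos hp]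
    _ ≤ Real.exp (a * ‖x‖ ^ 2) * ((‖fderiv ℝ v x‖ + 2 * |a| * ‖x‖ * |v x|) * ‖w‖) :=
        mul_le_mul_of_nonneg_left hmain hp.le
    _ = _ := by ring

/-- `‖D²(p v)(x)‖ ≤ p(x) (‖D²v(x)‖ + 4|a||x| ‖Dv(x)‖ + (4a²|x|² + 2|a|) |v(x)|)`. [folklore] -/
theorem norm_fderiv_fderiv_expWeight_mul_le (x : EuclideanSpace ℝ (Fin 2)) :
    ‖fderiv ℝ (fderiv ℝ (fun y : EuclideanSpace ℝ (Fin 2) => Real.exp (a * ‖y‖ ^ 2) * v y)) x‖ ≤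
      Real.exp (a * ‖x‖ ^ 2) * (‖fderiv ℝ (fderiv ℝ v) x‖ + 4 * |a| * ‖x‖ * ‖fderiv ℝ v x‖ +
        (4 * a ^ 2 * ‖x‖ ^ 2 + 2 * |a|) * |v x|) := by
  have hp := Real.exp_pos (a * ‖x‖ ^ 2)
  refine ContinuousLinearMap.opNorm_le_bound _ (by positivity) fun v' =>
    ContinuousLinearMap.opNorm_le_bound _ (by positivity) fun w => ?_
  rw [fderiv_fderiv_expWeight_mul_apply hv a, Real.norm_eq_abs, abs_mul, abs_of_pos hp,
    show ∀ S : ℝ, Real.exp (a * ‖x‖ ^ 2) * S * ‖v'‖ * ‖w‖ = Real.exp (a * ‖x‖ ^ 2) * (S * ‖v'‖ * ‖w‖) from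
      fun S => by ring]
  refine mul_le_mul_of_nonneg_left ?_ hp.le
  have h1 : |fderiv ℝ v x w| ≤ ‖fderiv ℝ v x‖ * ‖w‖ := by
    rw [← Real.norm_eq_abs]; exact ContinuousLinearMap.le_opNorm _ _
  have h1' : |fderiv ℝ v x v'| ≤ ‖fderiv ℝ v x‖ * ‖v'‖ := by
    rw [← Real.norm_eq_abs]; exact ContinuousLinearMap.le_opNorm _ _
  have h2 : |⟪w, x⟫_ℝ| ≤ ‖w‖ * ‖x‖ := abs_real_inner_le_norm w x
  have h2' : |⟪v', x⟫_ℝ| ≤ ‖v'‖ * ‖x‖ := abs_real_inner_le_norm v' x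
  have h3 : |⟪w, v'⟫_ℝ| ≤ ‖w‖ * ‖v'‖ := abs_real_inner_le_norm w v'
  have h4 : |fderiv ℝ (fderiv ℝ v) x v' w| ≤ ‖fderiv ℝ (fderiv ℝ v) x‖ * ‖v'‖ * ‖w‖ := by
    rw [← Real.norm_eq_abs]; exact ContinuousLinearMap.le_opNorm₂ _ _ _
  have hA := abs_nonneg a
  have hx := norm_nonneg x
  have hv0 := abs_nonneg (v x)
  have hw := norm_nonneg w
  have hv'0 := norm_nonneg v'
  calc |2 * a * ⟪v', x⟫_ℝ * (fderiv ℝ v x w + 2 * a * ⟪w, x⟫_ℝ * v x) + fderiv ℝ (fderiv ℝ v) x v' w +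
        2 * a * ⟪w, v'⟫_ℝ * v x + 2 * a * ⟪w, x⟫_ℝ * fderiv ℝ v x v'|
      ≤ |2 * a * ⟪v', x⟫_ℝ * (fderiv ℝ v x w + 2 * a * ⟪w, x⟫_ℝ * v x)| + |fderiv ℝ (fderiv ℝ v) x v' w| +
        |2 * a * ⟪w, v'⟫_ℝ * v x| + |2 * a * ⟪w, x⟫_ℝ * fderiv ℝ v x v'| := by
        exact (abs_add_le _ _).trans (add_le_add ((abs_add_le _ _).trans (add_le_add (abs_add_le _ _) le_rfl))
          le_rfl)
    _ ≤ 2 * |a| * (‖v'‖ * ‖x‖) * (‖fderiv ℝ v x‖ * ‖w‖ + 2 * |a| * (‖w‖ * ‖x‖) * |v x|) +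
        ‖fderiv ℝ (fderiv ℝ v) x‖ * ‖v'‖ * ‖w‖ + 2 * |a| * (‖w‖ * ‖v'‖) * |v x| +
        2 * |a| * (‖w‖ * ‖x‖) * (‖fderiv ℝ v x‖ * ‖v'‖) := by
        gcongr
        · calc |2 * a * ⟪v', x⟫_ℝ * (fderiv ℝ v x w + 2 * a * ⟪w, x⟫_ℝ * v x)|
              = 2 * |a| * |⟪v', x⟫_ℝ| * |fderiv ℝ v x w + 2 * a * ⟪w, x⟫_ℝ * v x| := by
                simp only [abs_mul, abs_two]
            _ ≤ 2 * |a| * (‖v'‖ * ‖x‖) * (|fderiv ℝ v x w| + |2 * a * ⟪w, x⟫_ℝ * v x|) := by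
                gcongr; exact abs_add_le _ _
            _ = 2 * |a| * (‖v'‖ * ‖x‖) * (|fderiv ℝ v x w| + 2 * |a| * |⟪w, x⟫_ℝ| * |v x|) := by
                simp only [abs_mul, abs_two]
            _ ≤ _ := by gcongr
        · simp only [abs_mul, abs_two]; gcongr
        · simp only [abs_mul, abs_two]; gcongr
    _ = (‖fderiv ℝ (fderiv ℝ v) x‖ + 4 * |a| * ‖x‖ * ‖fderiv ℝ v x‖ +
          (4 * |a| ^ 2 * ‖x‖ ^ 2 + 2 * |a|) * |v x|) * ‖v'‖ * ‖w‖ := by ring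
    _ = _ := by rw [sq_abs]

end Conj


/-! ### Transfer of regularity, parity and Gaussian bounds from `v` to `ũ = e^{(1−λ)|x|²/8} v` -/

section Transfer

variable {v : EuclideanSpace ℝ (Fin 2) → ℝ} (hv : ContDiff ℝ 2 v) (lam : ℝ)

include hv in
/-- `ũ ∈ C²`. [folklore] -/
theorem contDiff_conj : ContDiff ℝ 2 fun y : EuclideanSpace ℝ (Fin 2) => Real.exp ((1 - lam) / 8 * ‖y‖ ^ 2) * v y :=
  (contDiff_expWeight _).mul hv

omit hv in
/-- `ũ` is odd when `v` is. [folklore] -/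
theorem conj_odd (hodd : ∀ x, v (-x) = -v x) (x : EuclideanSpace ℝ (Fin 2)) :
    Real.exp ((1 - lam) / 8 * ‖-x‖ ^ 2) * v (-x) = -(Real.exp ((1 - lam) / 8 * ‖x‖ ^ 2) * v x) := by
  rw [norm_neg, hodd]; ring

include hv in
/-- **Gaussian bounds transfer**: if `|v|, ‖Dv‖, ‖D²v‖ ≤ C(1+|x|)ᴺ e^{−|x|²/4}` and `0 ≤ λ ≤ 1`, then
`ũ = e^{(1−λ)|x|²/8} v` satisfies `|ũ|, ‖Dũ‖, ‖D²ũ‖ ≤ 2C(1+|x|)^{N+2} e^{−|x|²/8}`. [folklore] -/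
theorem conj_gaussDecay (hl0 : 0 ≤ lam) (hl1 : lam ≤ 1)
    (hvB : ∃ (C : ℝ) (N : ℕ), ∀ x : EuclideanSpace ℝ (Fin 2),
      |v x| ≤ C * (1 + ‖x‖) ^ N * Real.exp (-(‖x‖ ^ 2 / 4)) ∧
      ‖fderiv ℝ v x‖ ≤ C * (1 + ‖x‖) ^ N * Real.exp (-(‖x‖ ^ 2 / 4)) ∧
      ‖fderiv ℝ (fderiv ℝ v) x‖ ≤ C * (1 + ‖x‖) ^ N * Real.exp (-(‖x‖ ^ 2 / 4))) :
    ∃ (C : ℝ) (N : ℕ), ∀ x : EuclideanSpace ℝ (Fin 2),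
      |Real.exp ((1 - lam) / 8 * ‖x‖ ^ 2) * v x| ≤ C * (1 + ‖x‖) ^ N * Real.exp (-(1 / 8 * ‖x‖ ^ 2)) ∧
      ‖fderiv ℝ (fun y : EuclideanSpace ℝ (Fin 2) => Real.exp ((1 - lam) / 8 * ‖y‖ ^ 2) * v y) x‖ ≤
        C * (1 + ‖x‖) ^ N * Real.exp (-(1 / 8 * ‖x‖ ^ 2)) ∧
      ‖fderiv ℝ (fderiv ℝ (fun y : EuclideanSpace ℝ (Fin 2) => Real.exp ((1 - lam) / 8 * ‖y‖ ^ 2) * v y)) x‖ ≤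
        C * (1 + ‖x‖) ^ N * Real.exp (-(1 / 8 * ‖x‖ ^ 2)) := by
  obtain ⟨C, N, h⟩ := hvB
  have hC0 : 0 ≤ C := by
    have := (abs_nonneg _).trans (h 0).1; simpa using this
  set a : ℝ := (1 - lam) / 8 with ha
  have ha0 : 0 ≤ a := by rw [ha]; linarith
  have ha1 : a ≤ 1 / 8 := by rw [ha]; linarith
  have haa : |a| = a := abs_of_nonneg ha0
  refine ⟨2 * C, N + 2, fun x => ?_⟩
  obtain ⟨h0, h1, h2⟩ := h x
  have hr := norm_nonneg x
  have hp := Real.exp_pos (a * ‖x‖ ^ 2)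
  have hE := Real.exp_pos (-(1 / 8 * ‖x‖ ^ 2))
  -- `p e^{−|x|²/4} ≤ e^{−|x|²/8}`
  have hpe : Real.exp (a * ‖x‖ ^ 2) * Real.exp (-(‖x‖ ^ 2 / 4)) ≤ Real.exp (-(1 / 8 * ‖x‖ ^ 2)) := by
    rw [← Real.exp_add, Real.exp_le_exp]
    nlinarith [sq_nonneg ‖x‖]
  have hpB : Real.exp (a * ‖x‖ ^ 2) * (C * (1 + ‖x‖) ^ N * Real.exp (-(‖x‖ ^ 2 / 4))) ≤
      C * (1 + ‖x‖) ^ N * Real.exp (-(1 / 8 * ‖x‖ ^ 2)) := by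
    calc Real.exp (a * ‖x‖ ^ 2) * (C * (1 + ‖x‖) ^ N * Real.exp (-(‖x‖ ^ 2 / 4)))
        = C * (1 + ‖x‖) ^ N * (Real.exp (a * ‖x‖ ^ 2) * Real.exp (-(‖x‖ ^ 2 / 4))) := by ring
      _ ≤ C * (1 + ‖x‖) ^ N * Real.exp (-(1 / 8 * ‖x‖ ^ 2)) := mul_le_mul_of_nonneg_left hpe (by positivity)
  have hgrow : C * (1 + ‖x‖) ^ N * Real.exp (-(1 / 8 * ‖x‖ ^ 2)) * (2 * (1 + ‖x‖) ^ 2) =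
      2 * C * (1 + ‖x‖) ^ (N + 2) * Real.exp (-(1 / 8 * ‖x‖ ^ 2)) := by ring
  have hbase : 0 ≤ C * (1 + ‖x‖) ^ N * Real.exp (-(1 / 8 * ‖x‖ ^ 2)) := by positivity
  have hone : (1 : ℝ) ≤ 2 * (1 + ‖x‖) ^ 2 := by nlinarith
  refine ⟨?_, ?_, ?_⟩
  · rw [abs_mul, abs_of_pos hp]
    calc Real.exp (a * ‖x‖ ^ 2) * |v x| ≤ Real.exp (a * ‖x‖ ^ 2) * (C * (1 + ‖x‖) ^ N * Real.exp (-(‖x‖ ^ 2 / 4))) :=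
          mul_le_mul_of_nonneg_left h0 hp.le
      _ ≤ C * (1 + ‖x‖) ^ N * Real.exp (-(1 / 8 * ‖x‖ ^ 2)) * 1 := by rw [mul_one]; exact hpB
      _ ≤ C * (1 + ‖x‖) ^ N * Real.exp (-(1 / 8 * ‖x‖ ^ 2)) * (2 * (1 + ‖x‖) ^ 2) :=
          mul_le_mul_of_nonneg_left hone hbase
      _ = _ := hgrow
  · have hfac : 1 + 2 * |a| * ‖x‖ ≤ 2 * (1 + ‖x‖) ^ 2 := by rw [haa]; nlinarith
    calc _ ≤ Real.exp (a * ‖x‖ ^ 2) * (‖fderiv ℝ v x‖ + 2 * |a| * ‖x‖ * |v x|) := norm_fderiv_expWeight_mul_le hv a x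
      _ ≤ Real.exp (a * ‖x‖ ^ 2) * (C * (1 + ‖x‖) ^ N * Real.exp (-(‖x‖ ^ 2 / 4)) +
          2 * |a| * ‖x‖ * (C * (1 + ‖x‖) ^ N * Real.exp (-(‖x‖ ^ 2 / 4)))) := by gcongr
      _ = Real.exp (a * ‖x‖ ^ 2) * (C * (1 + ‖x‖) ^ N * Real.exp (-(‖x‖ ^ 2 / 4))) * (1 + 2 * |a| * ‖x‖) := by
          ring
      _ ≤ C * (1 + ‖x‖) ^ N * Real.exp (-(1 / 8 * ‖x‖ ^ 2)) * (2 * (1 + ‖x‖) ^ 2) :=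
          mul_le_mul hpB hfac (by positivity) hbase
      _ = _ := hgrow
  · have hfac : 1 + 4 * |a| * ‖x‖ + (4 * a ^ 2 * ‖x‖ ^ 2 + 2 * |a|) ≤ 2 * (1 + ‖x‖) ^ 2 := by
      rw [haa]
      nlinarith [mul_le_mul_of_nonneg_right ha1 hr, sq_nonneg ‖x‖,
        mul_le_mul_of_nonneg_right (mul_le_mul ha1 ha1 ha0 (by norm_num : (0 : ℝ) ≤ 1 / 8)) (sq_nonneg ‖x‖)]
    calc _ ≤ Real.exp (a * ‖x‖ ^ 2) * (‖fderiv ℝ (fderiv ℝ v) x‖ + 4 * |a| * ‖x‖ * ‖fderiv ℝ v x‖ +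
          (4 * a ^ 2 * ‖x‖ ^ 2 + 2 * |a|) * |v x|) := norm_fderiv_fderiv_expWeight_mul_le hv a x
      _ ≤ Real.exp (a * ‖x‖ ^ 2) * (C * (1 + ‖x‖) ^ N * Real.exp (-(‖x‖ ^ 2 / 4)) +
          4 * |a| * ‖x‖ * (C * (1 + ‖x‖) ^ N * Real.exp (-(‖x‖ ^ 2 / 4))) +
          (4 * a ^ 2 * ‖x‖ ^ 2 + 2 * |a|) * (C * (1 + ‖x‖) ^ N * Real.exp (-(‖x‖ ^ 2 / 4)))) := by gcongr
      _ = Real.exp (a * ‖x‖ ^ 2) * (C * (1 + ‖x‖) ^ N * Real.exp (-(‖x‖ ^ 2 / 4))) *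
          (1 + 4 * |a| * ‖x‖ + (4 * a ^ 2 * ‖x‖ ^ 2 + 2 * |a|)) := by ring
      _ ≤ C * (1 + ‖x‖) ^ N * Real.exp (-(1 / 8 * ‖x‖ ^ 2)) * (2 * (1 + ‖x‖) ^ 2) :=
          mul_le_mul hpB hfac (by positivity) hbase
      _ = _ := hgrow

/-! ### The conjugation identity for the local linearised operator -/

include hv in
/-- **Conjugation of `H = L_λ − R v^G·∇` by the isotropic weight `p = e^{(1−λ)|x|²/8}`**: with `ũ = p v`,
`p (L_λ v − R v^G·∇v) = Δũ + λ x₀∂₀ũ − ((1−λ)²/16 |x|² + λ(1−λ)/4 x₀²) ũ + ((1+λ)/2) ũ − R Ω ∂_θũ`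
pointwise (`Ω = (8π)⁻¹φ(|x|²/4)`, `∂_θ = D(·)[x^⊥]`; `v^G·∇v = Ω ∂_θv` and `∂_θp = 0`). [folklore] -/
theorem expWeight_mul_localOp_eq (R : ℝ) (x : EuclideanSpace ℝ (Fin 2)) :
    Real.exp ((1 - lam) / 8 * ‖x‖ ^ 2) *
        (strainedVorticityOperator lam v x - R * ⟪gaussVortexVelocity x, gradient v x⟫_ℝ) =
      Δ (fun y : EuclideanSpace ℝ (Fin 2) => Real.exp ((1 - lam) / 8 * ‖y‖ ^ 2) * v y) x +
        lam * x 0 * fderiv ℝ (fun y : EuclideanSpace ℝ (Fin 2) => Real.exp ((1 - lam) / 8 * ‖y‖ ^ 2) * v y) x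
          (EuclideanSpace.single 0 1) -
        ((1 - lam) ^ 2 / 16 * ‖x‖ ^ 2 + lam * (1 - lam) / 4 * x 0 ^ 2) *
          (Real.exp ((1 - lam) / 8 * ‖x‖ ^ 2) * v x) +
        (1 + lam) / 2 * (Real.exp ((1 - lam) / 8 * ‖x‖ ^ 2) * v x) -
        R * ((8 * Real.pi)⁻¹ * burgersPhi (‖x‖ ^ 2 / 4) *
          fderiv ℝ (fun y : EuclideanSpace ℝ (Fin 2) => Real.exp ((1 - lam) / 8 * ‖y‖ ^ 2) * v y) x (perp x)) := by
  set a : ℝ := (1 - lam) / 8 with ha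
  have hp2 : ContDiff ℝ 2 fun y : EuclideanSpace ℝ (Fin 2) => Real.exp (a * ‖y‖ ^ 2) := contDiff_expWeight a
  have hρi : ∀ (i : Fin 2) (y : EuclideanSpace ℝ (Fin 2)),
      fderiv ℝ (fun z : EuclideanSpace ℝ (Fin 2) => Real.exp (a * ‖z‖ ^ 2)) y (EuclideanSpace.single i (1 : ℝ)) =
        -((-4 * a) * y i / 2) * Real.exp (a * ‖y‖ ^ 2) := fun i y => fderiv_expWeight_single a i y
  have hΔu := Literature.Analysis.UnboundedOperators.laplacian_eq_sum_fderiv_fderiv_apply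
    (EuclideanSpace.basisFun (Fin 2) ℝ) (hp2.mul hv) x
  have hΔv := Literature.Analysis.UnboundedOperators.laplacian_eq_sum_fderiv_fderiv_apply
    (EuclideanSpace.basisFun (Fin 2) ℝ) hv x
  simp only [Fin.sum_univ_two, EuclideanSpace.basisFun_apply] at hΔu hΔv
  have h0 := congrFun (fderiv_weight_mul_apply_single hp2 hv 0 (hρi 0)) x
  simp only at h0
  have hθ : fderiv ℝ (fun y : EuclideanSpace ℝ (Fin 2) => Real.exp (a * ‖y‖ ^ 2) * v y) x (perp x) =
      Real.exp (a * ‖x‖ ^ 2) * fderiv ℝ v x (perp x) := by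
    rw [fderiv_expWeight_mul_apply hv a, real_inner_comm, inner_self_perp]; ring
  rw [strainedVorticityOperator, inner_gaussVortexVelocity_gradient_eq_mul_angularDeriv, hΔu, hΔv,
    fderiv_fderiv_weight_mul_apply_single hp2 hv 0 (hρi 0) x,
    fderiv_fderiv_weight_mul_apply_single hp2 hv 1 (hρi 1) x, h0, hθ,
    EuclideanSpace.real_norm_sq_eq x, Fin.sum_univ_two]
  rw [ha]
  ring

/-! ### The weight `G_λ⁻¹ = (4π/(1−λ)) p²` -/

omit hv in
/-- `G_λ⁻¹ w² = (4π/(1−λ)) (p w)²` pointwise. [folklore] -/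
theorem inv_gaussWeightLam_mul_sq_eq (x : EuclideanSpace ℝ (Fin 2)) (w : ℝ) :
    (gaussWeightLam lam x)⁻¹ * w ^ 2 = 4 * Real.pi / (1 - lam) * (Real.exp ((1 - lam) / 8 * ‖x‖ ^ 2) * w) ^ 2 := by
  rw [inv_gaussWeightLam_eq, inv_div, mul_pow, pow_two (Real.exp ((1 - lam) / 8 * ‖x‖ ^ 2)), ← Real.exp_add]
  ring_nf

omit hv in
/-- `∫ G_λ⁻¹ w² = (4π/(1−λ)) ∫ (p w)²`. [folklore] -/
theorem integral_inv_gaussWeightLam_mul_sq_eq (w : EuclideanSpace ℝ (Fin 2) → ℝ) :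
    ∫ x, (gaussWeightLam lam x)⁻¹ * w x ^ 2 =
      4 * Real.pi / (1 - lam) * ∫ x, (Real.exp ((1 - lam) / 8 * ‖x‖ ^ 2) * w x) ^ 2 := by
  rw [← integral_const_mul]
  exact integral_congr_ae (Eventually.of_forall fun x => inv_gaussWeightLam_mul_sq_eq lam x (w x))

end Transfer

/-- Registered tools stub of crux stmt-NavierStokesRegularity-17973 (`stub_oddAttenuationToolsH`):
the ground-state conjugation `ũ = e^{(1−λ)|x|²/8} v` — transfer of the Gaussian bounds, the
conjugation identity for the local operator, and `∫ G_λ⁻¹ w² = (4π/(1−λ)) ∫ (p w)²`. [folklore] -/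
theorem stub_oddAttenuationToolsH :
    (∀ (v : EuclideanSpace ℝ (Fin 2) → ℝ), ContDiff ℝ 2 v → ∀ lam : ℝ, 0 ≤ lam → lam ≤ 1 →
      (∃ (C : ℝ) (N : ℕ), ∀ x : EuclideanSpace ℝ (Fin 2),
        |v x| ≤ C * (1 + ‖x‖) ^ N * Real.exp (-(‖x‖ ^ 2 / 4)) ∧
        ‖fderiv ℝ v x‖ ≤ C * (1 + ‖x‖) ^ N * Real.exp (-(‖x‖ ^ 2 / 4)) ∧
        ‖fderiv ℝ (fderiv ℝ v) x‖ ≤ C * (1 + ‖x‖) ^ N * Real.exp (-(‖x‖ ^ 2 / 4))) →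
      ∃ (C : ℝ) (N : ℕ), ∀ x : EuclideanSpace ℝ (Fin 2),
        |Real.exp ((1 - lam) / 8 * ‖x‖ ^ 2) * v x| ≤ C * (1 + ‖x‖) ^ N * Real.exp (-(1 / 8 * ‖x‖ ^ 2)) ∧
        ‖fderiv ℝ (fun y : EuclideanSpace ℝ (Fin 2) => Real.exp ((1 - lam) / 8 * ‖y‖ ^ 2) * v y) x‖ ≤
          C * (1 + ‖x‖) ^ N * Real.exp (-(1 / 8 * ‖x‖ ^ 2)) ∧
        ‖fderiv ℝ (fderiv ℝ (fun y : EuclideanSpace ℝ (Fin 2) => Real.exp ((1 - lam) / 8 * ‖y‖ ^ 2) * v y)) x‖ ≤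
          C * (1 + ‖x‖) ^ N * Real.exp (-(1 / 8 * ‖x‖ ^ 2))) ∧
    (∀ (v : EuclideanSpace ℝ (Fin 2) → ℝ), ContDiff ℝ 2 v → ∀ (lam R : ℝ) (x : EuclideanSpace ℝ (Fin 2)),
      Real.exp ((1 - lam) / 8 * ‖x‖ ^ 2) *
          (strainedVorticityOperator lam v x - R * ⟪gaussVortexVelocity x, gradient v x⟫_ℝ) =
        Δ (fun y : EuclideanSpace ℝ (Fin 2) => Real.exp ((1 - lam) / 8 * ‖y‖ ^ 2) * v y) x +
          lam * x 0 * fderiv ℝ (fun y : EuclideanSpace ℝ (Fin 2) => Real.exp ((1 - lam) / 8 * ‖y‖ ^ 2) * v y) x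
            (EuclideanSpace.single 0 1) -
          ((1 - lam) ^ 2 / 16 * ‖x‖ ^ 2 + lam * (1 - lam) / 4 * x 0 ^ 2) *
            (Real.exp ((1 - lam) / 8 * ‖x‖ ^ 2) * v x) +
          (1 + lam) / 2 * (Real.exp ((1 - lam) / 8 * ‖x‖ ^ 2) * v x) -
          R * ((8 * Real.pi)⁻¹ * burgersPhi (‖x‖ ^ 2 / 4) *
            fderiv ℝ (fun y : EuclideanSpace ℝ (Fin 2) => Real.exp ((1 - lam) / 8 * ‖y‖ ^ 2) * v y) x (perp x))) ∧
    (∀ (lam : ℝ) (w : EuclideanSpace ℝ (Fin 2) → ℝ),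
      ∫ x, (gaussWeightLam lam x)⁻¹ * w x ^ 2 =
        4 * Real.pi / (1 - lam) * ∫ x, (Real.exp ((1 - lam) / 8 * ‖x‖ ^ 2) * w x) ^ 2) :=
  ⟨fun _ hv lam hl0 hl1 hvB => conj_gaussDecay hv lam hl0 hl1 hvB,
    fun _ hv lam R x => expWeight_mul_localOp_eq hv lam R x,
    fun lam w => integral_inv_gaussWeightLam_mul_sq_eq lam w⟩

end Summit.NavierStokesRegularity.NavierStokesRegularity.Theorems
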